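import Literature.AlgebraicGeometry.Resolution.QuadraticTransformNormalization
import Literature.AlgebraicGeometry.Resolution.FlatSlicingCriterion
import Mathlib.RingTheory.Artinian.Ring
import HarnessLib

/-!
# The normalization of a quadratic transform: finiteness and the approximation surjection

Topic: `Literature/AlgebraicGeometry/Resolution`. Continuation of
`QuadraticTransformNormalization.lean` (Kollár 2007, Thm. 1.101 (3) ⇒ (1), reduced case). Same
data: `(R, 𝔪)` reduced Noetherian local of dimension one with total ring of fractions `K` and
module-finite normalization `R̄ ⊆ K`, a non-zero-divisor `c ∈ 𝔪`, a chart subalgebra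
`𝔪/c ⊆ B ⊆ ⋃ 𝔪ⁿ/cⁿ`, a prime `𝔴 ⊆ B`, the quadratic transform `R' = B_𝔴` and its total ring of
fractions `Q' = K_𝔴`; `R̄'` denotes the integral closure of `R'` in `Q'`. PROVED here:

* `surjective_quotient_mk_comp_of_forall_isUnit` — an abstract approximation lemma: if every
  element of an `A`-algebra `S` is a fraction `θ(a)/θ(w)` with `θ(w)` a unit, and every
  non-zero-divisor of `A/θ⁻¹(I)` is a unit, then `A → S/I` is surjective;
* `QuadraticTransform.exists_unit_data` — an element `u' ∈ R̄` with `B ⊆ R̄[u'⁻¹]` whose image in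
  `Q'` is a unit of `R̄'` (`c = g u'`, `𝔪R̄ = gR̄`);
* `QuadraticTransform.exists_fraction` — every element of `R̄'` is a fraction `ā/w̄` with
  `a, w ∈ R̄` and `w̄` a unit;
* `exists_pow_maximalIdeal_le_span_of_mem_nonZeroDivisors`,
  `QuadraticTransform.exists_pow_mul_mem_range` — `𝔪ⁿ ⊆ (d)` for a non-zero-divisor `d`
  (dimension one), whence `c^M R̄ ⊆ R` for some `M`;
* `QuadraticTransform.exists_sub_mem_of_pow` — **`R̄ → R̄'/c^M R̄'` is surjective** (the local
  form of "blow-up followed by normalization": `R̄/c^M R̄` is Artinian).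

No definitions, no named facts. Source: J. Kollár, *Lectures on Resolution of Singularities*
(2007), §1.13, Thm. 1.101 [Kollar2007].
-/

noncomputable section

open IsLocalRing Polynomial nonZeroDivisors

namespace Literature.AlgebraicGeometry.Resolution

universe u

/-! ## An abstract approximation lemma -/

section Approx

/-- Let `θ : A → S` be a ring homomorphism such that every element of `S` is a fraction
`θ(a) θ(w)⁻¹` with `θ(w)` a unit, and let `I ⊆ S` be an ideal such that every non-zero-divisor of
`A/θ⁻¹(I)` is a unit (e.g. `A/θ⁻¹(I)` Artinian). Then `A → S/I` is surjective: the class of `w`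
in `A/θ⁻¹(I)` is a non-zero-divisor, hence has an inverse `w̃`, and `θ(a w̃) ≡ θ(a)θ(w)⁻¹`.
(The local form of the surjection `S → S_𝔫/𝔫ᵏ` for a localization; Kollár's blow-up sequence
descends along such maps.) [cite: Kollar2007, Thm. 1.101] -/
theorem surjective_quotient_mk_comp_of_forall_isUnit {A S : Type u} [CommRing A] [CommRing S]
    (θ : A →+* S) (I : Ideal S)
    (hfrac : ∀ s : S, ∃ a w : A, IsUnit (θ w) ∧ s * θ w = θ a)
    (hA : ∀ a : A ⧸ I.comap θ, a ∈ (A ⧸ I.comap θ)⁰ → IsUnit a) :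
    Function.Surjective ((Ideal.Quotient.mk I).comp θ) := by
  intro s
  obtain ⟨s, rfl⟩ := Ideal.Quotient.mk_surjective s
  obtain ⟨a, w, hw, hs⟩ := hfrac s
  -- the class of `w` is a non-zero-divisor of `A/θ⁻¹(I)`
  have hw0 : Ideal.Quotient.mk (I.comap θ) w ∈ (A ⧸ I.comap θ)⁰ := by
    rw [mem_nonZeroDivisors_iff_right]
    intro y hy
    obtain ⟨y, rfl⟩ := Ideal.Quotient.mk_surjective y
    rw [← map_mul, Ideal.Quotient.eq_zero_iff_mem, Ideal.mem_comap, map_mul] at hy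
    rw [Ideal.Quotient.eq_zero_iff_mem, Ideal.mem_comap]
    obtain ⟨wi, hwi⟩ := hw.exists_left_inv
    have : θ y = wi * (θ y * θ w) := by rw [mul_comm (θ y), ← mul_assoc, hwi, one_mul]
    rw [this]
    exact I.mul_mem_left _ hy
  obtain ⟨wt, hwt⟩ := (hA _ hw0).exists_right_inv
  obtain ⟨wt, rfl⟩ := Ideal.Quotient.mk_surjective wt
  rw [← map_mul, ← map_one (Ideal.Quotient.mk (I.comap θ)), Ideal.Quotient.eq,
    Ideal.mem_comap, map_sub, map_one, map_mul] at hwt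
  refine ⟨a * wt, ?_⟩
  rw [RingHom.comp_apply, Ideal.Quotient.eq, map_mul]
  -- `θ a θ wt - s = s (θ w θ wt - 1)`
  have : θ a * θ wt - s = s * (θ w * θ wt - 1) := by rw [← hs]; ring
  rw [this]
  exact I.mul_mem_left _ hwt

end Approx

/-! ## Powers of `𝔪` inside principal ideals of non-zero-divisors -/

section PowLe

/-- In a Noetherian local ring of dimension `≤ 1`, a power of `𝔪` lies in `(d)` for every
non-zero-divisor `d` (the primes containing `d` are not minimal, hence equal `𝔪`); so
`c^M ∈ (d)` for every `c ∈ 𝔪` — the conductor of the normalization contains a power of `c`.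
[cite: Kollar2007, Thm. 1.101] -/
theorem exists_pow_maximalIdeal_le_span_of_mem_nonZeroDivisors (R : Type u) [CommRing R]
    [IsLocalRing R] [IsNoetherianRing R] (hdim : ringKrullDim R ≤ 1) {d : R} (hd : d ∈ R⁰) :
    ∃ n : ℕ, maximalIdeal R ^ n ≤ Ideal.span {d} := by
  have hle : maximalIdeal R ≤ (Ideal.span {d}).radical := by
    rw [Ideal.radical_eq_sInf]
    refine le_sInf ?_
    rintro P ⟨hdP, hP⟩
    haveI := hP
    -- `P` is not a minimal prime (it contains a non-zero-divisor), so `P = 𝔪`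
    have hPnot : P ∉ minimalPrimes R := fun hmin =>
      Set.disjoint_left.mp (Ideal.disjoint_nonZeroDivisors_of_mem_minimalPrimes hmin)
        (hdP (Ideal.mem_span_singleton_self d)) hd
    have hPh : P.height ≠ 0 := fun h0 => hPnot (Ideal.height_eq_zero_iff.mp h0)
    by_contra hPM
    have hlt : P < maximalIdeal R := lt_of_le_of_ne (IsLocalRing.le_maximalIdeal hP.ne_top)
      fun h => hPM (h ▸ le_rfl)
    have h1 := Ideal.height_add_one_le_of_lt_of_isPrime hlt
    have h2 : ((maximalIdeal R).height : WithBot ℕ∞) ≤ 1 := by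
      rw [IsLocalRing.maximalIdeal_height_eq_ringKrullDim]; exact hdim
    have h3 : (maximalIdeal R).height ≤ 1 := by exact_mod_cast h2
    have h4 : P.height + 1 ≤ 1 := h1.trans h3
    have htop : P.height ≠ ⊤ := by
      intro h; rw [h, top_add] at h4; exact absurd h4 (by simp)
    exact hPh (Order.lt_one_iff.mp ((ENat.add_one_le_iff htop).mp h4))
  exact Ideal.exists_pow_le_of_le_radical_of_fg hle (IsNoetherian.noetherian _)

end PowLe

namespace QuadraticTransform

variable {R : Type u} [CommRing R] [IsLocalRing R] [IsNoetherianRing R] [IsReduced R]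
  {K : Type u} [CommRing K] [Algebra R K] [IsFractionRing R K]
  {B : Subalgebra R K} (𝔴 : Ideal B) [𝔴.IsPrime]
  (R' : Type u) [CommRing R'] [Algebra B R'] [IsLocalization.AtPrime R' 𝔴]
  [Algebra R R']
  (Q' : Type u) [CommRing Q'] [Algebra K Q']
  [IsLocalization (𝔴.primeCompl.map (algebraMap B K)) Q']
  [Algebra R' Q'] [Algebra R Q'] [IsScalarTower B R' Q'] [IsScalarTower R K Q']
  [IsScalarTower R R' Q']

include 𝔴 R' Q'

/-! ## The unit `u'` and fractions -/

omit 𝔴 [IsLocalization.AtPrime R' 𝔴] [IsLocalization (𝔴.primeCompl.map (algebraMap B K)) Q']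
  [𝔴.IsPrime] [Algebra R R'] [Algebra R Q'] [IsScalarTower R K Q'] [IsScalarTower R R' Q'] in
/-- There is `u' ∈ R̄` with `B ⊆ R̄[u'⁻¹]` whose image in `Q'` is a unit of the integral closure of
`R'`: with `𝔪R̄ = gR̄` (`R̄` is a principal ideal ring) and `c = u' g`, every `b ∈ 𝔪ⁿ/cⁿ` has
`u'ⁿ b ∈ gⁿR̄/gⁿ = R̄`, and the inverse of `u'` is `g/c ∈ R'·R̄` since `𝔪/c ⊆ B`.
[cite: Kollar2007, Thm. 1.101] -/
theorem exists_unit_data (hdim : ringKrullDim R = 1) [Module.Finite R (integralClosure R K)]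
    {c : R} (hc : c ∈ maximalIdeal R) (hc0 : c ∈ R⁰)
    (hB1 : ∀ m ∈ maximalIdeal R, ∃ b ∈ B, algebraMap R K m = algebraMap R K c * b)
    (hB2 : ∀ b ∈ B, ∃ n : ℕ, ∃ m ∈ maximalIdeal R ^ n,
      algebraMap R K (c ^ n) * b = algebraMap R K m) :
    ∃ u' ∈ integralClosure R K, (∀ b ∈ B, ∃ k : ℕ, u' ^ k * b ∈ integralClosure R K) ∧
      ∃ v ∈ Algebra.adjoin R' (algebraMap K Q' '' (integralClosure R K : Set K)),
        algebraMap K Q' u' * v = 1 := by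
  classical
  set N := integralClosure R K with hN
  set lam := algebraMap K Q' with hlam
  set V : Subalgebra R' Q' := Algebra.adjoin R' (lam '' (N : Set K)) with hV
  have hlamB : ∀ b : B, lam (b : K) = algebraMap R' Q' (algebraMap B R' b) := fun b => by
    rw [← IsScalarTower.algebraMap_apply B R' Q' b]; rfl
  have hBV : ∀ b : B, lam (b : K) ∈ V := fun b => by
    rw [hlamB]; exact V.algebraMap_mem _
  have hNV : ∀ n ∈ N, lam n ∈ V := fun n hn => Algebra.subset_adjoin ⟨n, hn, rfl⟩
  have hcK : IsUnit (algebraMap R K c) := IsLocalization.map_units K ⟨c, hc0⟩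
  have hcQ : IsUnit (lam (algebraMap R K c)) := hcK.map _
  haveI hPIR := isPrincipalIdealRing_integralClosure R K hdim
  set J : Ideal N := (maximalIdeal R).map (algebraMap R N) with hJ
  obtain ⟨g, hg⟩ := (hPIR.principal J).principal
  have hgJ : g ∈ J := by rw [hg]; exact Ideal.mem_span_singleton_self g
  have hmemJ : ∀ m ∈ maximalIdeal R, algebraMap R N m ∈ J := fun m hm =>
    Ideal.mem_map_of_mem _ hm
  obtain ⟨u', hu'⟩ := Ideal.mem_span_singleton'.mp (hg ▸ hmemJ c hc : algebraMap R N c ∈ _)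
  have hcug : algebraMap R K c = (u' : K) * (g : K) := by
    have := congrArg (fun x : N => (x : K)) hu'
    simpa using this.symm
  have hgK : IsUnit (g : K) := isUnit_of_mul_isUnit_right (hcug ▸ hcK)
  refine ⟨u', u'.2, ?_, ?_⟩
  · intro b hb
    obtain ⟨n, m, hm, hmb⟩ := hB2 b hb
    have hmJ : algebraMap R N m ∈ J ^ n := by
      rw [hJ, ← Ideal.map_pow]; exact Ideal.mem_map_of_mem _ hm
    rw [hg, Ideal.span_singleton_pow] at hmJ
    obtain ⟨a, ha⟩ := Ideal.mem_span_singleton'.mp hmJ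
    refine ⟨n, ?_⟩
    have h1 : ((u' : K) * (g : K)) ^ n * b = (a : K) * (g : K) ^ n := by
      rw [← hcug, ← map_pow, hmb]
      have := congrArg (fun x : N => (x : K)) ha
      simpa using this.symm
    have h2 : (g : K) ^ n * ((u' : K) ^ n * b) = (g : K) ^ n * (a : K) := by
      rw [← mul_assoc, ← mul_pow, mul_comm (g : K), h1, mul_comm]
    rw [(hgK.pow n).mul_right_injective h2]
    exact a.2
  · have hP : ∀ x ∈ J, ∃ v ∈ V, lam (x : K) = lam (algebraMap R K c) * v := by
      intro x hx
      rw [hJ, Ideal.map] at hx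
      induction hx using Submodule.span_induction with
      | mem x hx =>
        obtain ⟨m, hm, rfl⟩ := hx
        obtain ⟨b, hb, hmb⟩ := hB1 m hm
        refine ⟨lam b, hBV ⟨b, hb⟩, ?_⟩
        change lam (algebraMap R K m) = _
        rw [hmb, map_mul]
      | zero => exact ⟨0, V.zero_mem, by simp⟩
      | add x y _ _ hx hy =>
        obtain ⟨v, hv, hxv⟩ := hx
        obtain ⟨w, hw, hyw⟩ := hy
        refine ⟨v + w, V.add_mem hv hw, ?_⟩
        rw [Subalgebra.coe_add, map_add, hxv, hyw, mul_add]
      | smul a x _ hx =>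
        obtain ⟨v, hv, hxv⟩ := hx
        refine ⟨lam (a : K) * v, V.mul_mem (hNV _ a.2) hv, ?_⟩
        rw [smul_eq_mul, Subalgebra.coe_mul, map_mul, hxv, mul_left_comm]
    obtain ⟨v, hvV, hgv⟩ := hP g hgJ
    refine ⟨v, hvV, ?_⟩
    have h1 : lam (algebraMap R K c) * (lam (u' : K) * v) = lam (algebraMap R K c) * 1 := by
      rw [mul_one, mul_left_comm, ← hgv, ← map_mul, ← hcug]
    exact hcQ.mul_right_injective h1

/-- Every element of the integral closure `R̄'` of `R'` in `Q'` is a fraction `λ(a) λ(w)⁻¹` with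
`a, w ∈ R̄` and `λ(w)` a unit (`R̄' = R'·λ(R̄)`, `R' = B_𝔴`, `B ⊆ R̄[u'⁻¹]`, `λ(u')` a unit).
[cite: Kollar2007, Thm. 1.101] -/
theorem exists_fraction (hdim : ringKrullDim R = 1) [Module.Finite R (integralClosure R K)]
    {c : R} (hc : c ∈ maximalIdeal R) (hc0 : c ∈ R⁰)
    (hB1 : ∀ m ∈ maximalIdeal R, ∃ b ∈ B, algebraMap R K m = algebraMap R K c * b)
    (hB2 : ∀ b ∈ B, ∃ n : ℕ, ∃ m ∈ maximalIdeal R ^ n,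
      algebraMap R K (c ^ n) * b = algebraMap R K m)
    (x : Q') (hxint : x ∈ integralClosure R' Q') :
    ∃ a ∈ integralClosure R K, ∃ w ∈ integralClosure R K, ∃ wi ∈ integralClosure R' Q',
      algebraMap K Q' w * wi = 1 ∧ x * algebraMap K Q' w = algebraMap K Q' a := by
  classical
  set N := integralClosure R K with hN
  set N' := integralClosure R' Q' with hN'
  set lam := algebraMap K Q' with hlam
  obtain ⟨u', hu'N, hBN, v, hvV, hu'v⟩ :=
    exists_unit_data R' Q' hdim hc hc0 hB1 hB2
  have hvN' : v ∈ N' := adjoin_le_integralClosure R' Q' hvV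
  have hlamB : ∀ b : B, lam (b : K) = algebraMap R' Q' (algebraMap B R' b) := fun b => by
    rw [← IsScalarTower.algebraMap_apply B R' Q' b]; rfl
  -- `x` lies in the span of `λ(R̄)` over `R'`
  have hx' : x ∈ Subalgebra.toSubmodule (Algebra.adjoin R' (lam '' (N : Set K))) :=
    integralClosure_le_adjoin 𝔴 R' Q' hdim hc hc0 hB1 hB2 hxint
  rw [Algebra.adjoin_eq_span] at hx'
  have hclos : (Submonoid.closure (lam '' (N : Set K)) : Set Q') = lam '' (N : Set K) := by
    have : lam '' (N : Set K) = (N.toSubmonoid.map (lam : K →* Q') : Set Q') := by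
      ext; simp
    rw [this, Submonoid.closure_eq]
  rw [hclos] at hx'
  clear hxint
  -- induction over the span
  refine Submodule.span_induction (p := fun x _ => ∃ a ∈ N, ∃ w ∈ N, ∃ wi ∈ N',
      lam w * wi = 1 ∧ x * lam w = lam a) ?_ ?_ ?_ ?_ hx'
  · rintro _ ⟨n, hn, rfl⟩
    exact ⟨n, hn, 1, N.one_mem, 1, N'.one_mem, by simp, by simp⟩
  · exact ⟨0, N.zero_mem, 1, N.one_mem, 1, N'.one_mem, by simp, by simp⟩
  · rintro x y - - ⟨a₁, ha₁, w₁, hw₁, i₁, hi₁, hu₁, h₁⟩ ⟨a₂, ha₂, w₂, hw₂, i₂, hi₂, hu₂, h₂⟩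
    refine ⟨a₁ * w₂ + a₂ * w₁, N.add_mem (N.mul_mem ha₁ hw₂) (N.mul_mem ha₂ hw₁),
      w₁ * w₂, N.mul_mem hw₁ hw₂, i₁ * i₂, N'.mul_mem hi₁ hi₂, ?_, ?_⟩
    · rw [map_mul]
      calc lam w₁ * lam w₂ * (i₁ * i₂) = (lam w₁ * i₁) * (lam w₂ * i₂) := by ring
        _ = 1 := by rw [hu₁, hu₂, one_mul]
    · rw [map_add, map_mul, map_mul, map_mul, add_mul, ← h₁, ← h₂]; ring
  · rintro r x - ⟨a, ha, w, hw, wi, hwi, hu, h⟩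
    -- `r = b/s` with `b ∈ B`, `s ∉ 𝔴`; `u'ᵏ b, u'ᵏ s ∈ R̄`
    obtain ⟨⟨b, s⟩, hr⟩ := IsLocalization.surj 𝔴.primeCompl r
    obtain ⟨k₁, hk₁⟩ := hBN (b : K) b.2
    obtain ⟨k₂, hk₂⟩ := hBN ((s : B) : K) (s : B).2
    obtain ⟨si, hsi⟩ := (IsLocalization.map_units R' s).exists_right_inv
    have hsu : lam ((s : B) : K) * algebraMap R' Q' si = 1 := by
      rw [hlamB, ← map_mul, hsi, map_one]
    refine ⟨u' ^ k₂ * a * (u' ^ k₁ * b), N.mul_mem (N.mul_mem (N.pow_mem hu'N _) ha) hk₁,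
      w * (u' ^ k₁ * (u' ^ k₂ * (s : B))), N.mul_mem hw (N.mul_mem (N.pow_mem hu'N _) hk₂),
      wi * (v ^ k₁ * (v ^ k₂ * algebraMap R' Q' si)),
      N'.mul_mem hwi (N'.mul_mem (N'.pow_mem hvN' _) (N'.mul_mem (N'.pow_mem hvN' _)
        (N'.algebraMap_mem si))), ?_, ?_⟩
    · simp only [map_mul, map_pow]
      calc lam w * (lam u' ^ k₁ * (lam u' ^ k₂ * lam ↑↑s)) *
            (wi * (v ^ k₁ * (v ^ k₂ * algebraMap R' Q' si)))
          = (lam w * wi) * (lam u' * v) ^ k₁ * (lam u' * v) ^ k₂ *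
              (lam ((s : B) : K) * algebraMap R' Q' si) := by ring
        _ = 1 := by rw [hu, hu'v, hsu]; simp
    · have hr' : algebraMap R' Q' r * lam ((s : B) : K) = lam (b : K) := by
        rw [hlamB, hlamB, ← map_mul, hr]
      rw [Algebra.smul_def]
      simp only [map_mul, map_pow]
      calc algebraMap R' Q' r * x * (lam w * (lam u' ^ k₁ * (lam u' ^ k₂ * lam ↑↑s)))
          = lam u' ^ k₂ * (x * lam w) * lam u' ^ k₁ *
              (algebraMap R' Q' r * lam ((s : B) : K)) := by ring
        _ = lam u' ^ k₂ * lam a * (lam u' ^ k₁ * lam ↑b) := by rw [h, hr']; ring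

/-! ## The conductor power and the approximation surjection -/

omit 𝔴 R' Q' [𝔴.IsPrime] [IsLocalization.AtPrime R' 𝔴]
  [IsLocalization (𝔴.primeCompl.map (algebraMap B K)) Q'] [Algebra R R'] [Algebra R Q']
  [IsScalarTower B R' Q'] [IsScalarTower R K Q'] [IsScalarTower R R' Q'] [Algebra B R']
  [CommRing R'] [CommRing Q'] [Algebra K Q'] [Algebra R' Q'] [IsReduced R] in
/-- **`c^M R̄ ⊆ R`**: the conductor of the module-finite normalization contains a
non-zero-divisor `d`, and `c^M ∈ (d)` for `c ∈ 𝔪` (dimension one).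
[cite: Kollar2007, Thm. 1.101] -/
theorem exists_pow_mul_mem_range (hdim : ringKrullDim R = 1)
    [Module.Finite R (integralClosure R K)] {c : R} (hc : c ∈ maximalIdeal R) :
    ∃ M : ℕ, ∀ z ∈ integralClosure R K,
      algebraMap R K (c ^ M) * z ∈ (algebraMap R K).range := by
  obtain ⟨d, hd0, hd⟩ := exists_mem_nonZeroDivisors_forall_mul_mem_range R K
  obtain ⟨M, hM⟩ := exists_pow_maximalIdeal_le_span_of_mem_nonZeroDivisors R hdim.le hd0
  refine ⟨M, fun z hz => ?_⟩
  have hcM : c ^ M ∈ Ideal.span {d} := hM (Ideal.pow_mem_pow hc M)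
  obtain ⟨a, ha⟩ := Ideal.mem_span_singleton'.mp hcM
  obtain ⟨r, hr⟩ := hd z hz
  refine ⟨a * r, ?_⟩
  rw [← ha, map_mul, map_mul, hr, mul_assoc]

/-- **`R̄ → R̄'/c^M R̄'` is surjective** for every `M`: every `y` in the integral closure `R̄'` of
`R'` in `Q'` is `λ(n) + c^M z` with `n ∈ R̄`, `z ∈ R̄'`. By the approximation lemma: elements of
`R̄'` are fractions `λ(a)/λ(w)` (`exists_fraction`), and `R̄/(c^M R̄' ∩ R̄)` is a quotient of the
Artinian ring `R̄/c^M R̄` (a finite module over the Artinian ring `R/(c^M)`), so its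
non-zero-divisors are units. [cite: Kollar2007, Thm. 1.101] -/
theorem exists_sub_mem_of_pow (hdim : ringKrullDim R = 1) [Module.Finite R (integralClosure R K)]
    {c : R} (hc : c ∈ maximalIdeal R) (hc0 : c ∈ R⁰)
    (hB1 : ∀ m ∈ maximalIdeal R, ∃ b ∈ B, algebraMap R K m = algebraMap R K c * b)
    (hB2 : ∀ b ∈ B, ∃ n : ℕ, ∃ m ∈ maximalIdeal R ^ n,
      algebraMap R K (c ^ n) * b = algebraMap R K m)
    (M : ℕ) (y : Q') (hy : y ∈ integralClosure R' Q') :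
    ∃ n ∈ integralClosure R K, ∃ z ∈ integralClosure R' Q',
      y = algebraMap K Q' n + algebraMap R Q' (c ^ M) * z := by
  classical
  set N := integralClosure R K with hN
  set N' := integralClosure R' Q' with hN'
  set lam := algebraMap K Q' with hlam
  have hNN' : ∀ n ∈ N, lam n ∈ N' := fun n hn =>
    adjoin_le_integralClosure R' Q' (Algebra.subset_adjoin ⟨n, hn, rfl⟩)
  -- the ring homomorphism `θ : R̄ → R̄'`
  let θ : N →+* N' :=
    { toFun := fun n => ⟨lam n, hNN' n n.2⟩
      map_one' := Subtype.ext (by simp)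
      map_mul' := fun x y => Subtype.ext (by simp)
      map_zero' := Subtype.ext (by simp)
      map_add' := fun x y => Subtype.ext (by simp) }
  have hθ : ∀ n : N, ((θ n : N') : Q') = lam n := fun n => rfl
  -- the element `c^M` of `R̄'` and the ideal it generates
  have hcQ : algebraMap R Q' (c ^ M) = lam (algebraMap R K (c ^ M)) :=
    IsScalarTower.algebraMap_apply R K Q' _
  set cM : N' := ⟨algebraMap R Q' (c ^ M), by
    rw [IsScalarTower.algebraMap_apply R R' Q']; exact N'.algebraMap_mem _⟩ with hcMdef
  set I : Ideal N' := Ideal.span {cM} with hI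
  -- (1) fractions
  have hfrac : ∀ s : N', ∃ a w : N, IsUnit (θ w) ∧ s * θ w = θ a := by
    intro s
    obtain ⟨a, ha, w, hw, wi, hwi, hu, h⟩ := exists_fraction 𝔴 R' Q' hdim hc hc0 hB1 hB2 s s.2
    refine ⟨⟨a, ha⟩, ⟨w, hw⟩, ?_, Subtype.ext h⟩
    exact IsUnit.of_mul_eq_one ⟨wi, hwi⟩ (Subtype.ext hu)
  -- (2) `R̄ / θ⁻¹(I)` is Artinian
  set J : Ideal N := I.comap θ with hJ
  have hcJ : algebraMap R N (c ^ M) ∈ J := by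
    rw [hJ, Ideal.mem_comap, hI]
    have : θ (algebraMap R N (c ^ M)) = cM := by
      apply Subtype.ext
      change lam _ = algebraMap R Q' (c ^ M)
      rw [hcQ]
      rfl
    rw [this]
    exact Ideal.mem_span_singleton_self _
  obtain ⟨n₀, hn₀⟩ := exists_pow_maximalIdeal_le_span_of_mem_nonZeroDivisors R hdim.le
    (pow_mem hc0 M)
  have hfinR : IsFiniteLength R (R ⧸ Ideal.span {c ^ M}) :=
    Matsumura1987.isFiniteLength_quotient_of_pow_le hn₀
  haveI : IsArtinian R (R ⧸ Ideal.span {c ^ M}) :=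
    ((isFiniteLength_iff_isNoetherian_isArtinian).mp hfinR).2
  haveI : IsArtinianRing (R ⧸ Ideal.span {c ^ M}) := isArtinian_of_tower R inferInstance
  haveI : Module.Finite R (N ⧸ J) :=
    Module.Finite.of_surjective (Ideal.Quotient.mkₐ R J).toLinearMap
      (Ideal.Quotient.mkₐ_surjective R J)
  have htors : Module.IsTorsionBySet R (N ⧸ J) (Ideal.span {c ^ M} : Set R) := by
    rw [Module.isTorsionBySet_span_singleton_iff]
    intro q
    obtain ⟨n, rfl⟩ := Ideal.Quotient.mk_surjective q
    change Ideal.Quotient.mk J (c ^ M • n) = 0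
    rw [Ideal.Quotient.eq_zero_iff_mem, Algebra.smul_def]
    exact J.mul_mem_right _ hcJ
  letI : Module (R ⧸ Ideal.span {c ^ M}) (N ⧸ J) := htors.module
  haveI : IsScalarTower R (R ⧸ Ideal.span {c ^ M}) (N ⧸ J) := htors.isScalarTower
  haveI : Module.Finite (R ⧸ Ideal.span {c ^ M}) (N ⧸ J) :=
    Module.Finite.of_restrictScalars_finite R _ _
  haveI : IsArtinian R (N ⧸ J) :=
    isArtinian_of_surjective_algebraMap (R := R ⧸ Ideal.span {c ^ M}) (S := R)
      Ideal.Quotient.mk_surjective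
  haveI : IsArtinianRing (N ⧸ J) := isArtinian_of_tower R inferInstance
  have hA : ∀ a : N ⧸ J, a ∈ (N ⧸ J)⁰ → IsUnit a := fun a ha =>
    IsArtinianRing.isUnit_of_mem_nonZeroDivisors ha
  -- (3) apply the approximation lemma
  obtain ⟨n, hn⟩ := surjective_quotient_mk_comp_of_forall_isUnit θ I hfrac hA
    (Ideal.Quotient.mk I ⟨y, hy⟩)
  rw [RingHom.comp_apply, Ideal.Quotient.eq, hI, Ideal.mem_span_singleton'] at hn
  obtain ⟨z, hz⟩ := hn
  refine ⟨n, n.2, -z, N'.neg_mem z.2, ?_⟩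
  have hz' := congrArg (fun t : N' => (t : Q')) hz
  simp only [Subalgebra.coe_mul, Subalgebra.coe_sub, hθ] at hz'
  change (z : Q') * algebraMap R Q' (c ^ M) = lam n - y at hz'
  linear_combination hz'

end QuadraticTransform

end Literature.AlgebraicGeometry.Resolution

end
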